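import Summits.ResolutionOfSingularities.ResolutionOfSingularities.Theses.QuotientModels
import Literature.AlgebraicGeometry.Resolution.ZariskiPatchingGlue

/-!
# QuotientModels — MinimalHeight kernels, part 1: Frobenius tower (decomp-res lens-4 gen 3)

Post-birth theorems for route `QuotientModels` (the cell's merged models-half child of `Dominance`),
from the lens-4 node `MinimalHeight` (HOME/decomp-res-lens-4/g3/MinimalHeight.lean, same proofs;
land file sha256 3788695a… split in two by the route-writer to meet the 400-line cap):

* per-prime bodies `PialtModelsAt` / `HeightOneDescentAt` / `HeightOneDescentSimpleAt` of the route
  items P (27198) / H (27195) / H° (one radical);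
* `regModel_of_pialtModels_of_heightOneDescent` : P ∧ H ⇒ `ProperModel.RegModel p` over ALL ground
  fields, WITHOUT the Galois tower C' (Frobenius tower `T_i = K(L^(p^i))`, induction on
  `IsPurelyInseparable.exponent`), and the exact bisection `regModel_iff`;
* infrastructure: `ProperModel.ofAlgEquiv` (transport along `K₁ ≃ₐ[k] K₂`),
  `ProperModel.nonempty_of_essFiniteType`, `descent_step`.

Part 2 (`QuotientModelsMinimalHeight.lean`) proves H ⟺ H° and the route-level iffs.
Sources: Temkin 2013 (arXiv:0804.1554, Conj. 1.1 / Thm. 1.2), Temkin 2017 (arXiv:1508.06255, Thm. 2)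
for the status of P; Jacobson (exponent-one theory) for H°; Zariski 1944 / Piltant 2013 via
`ProperModelsRegModel`. 0 sorry.
-/

set_option linter.dupNamespace false

noncomputable section

open CategoryTheory AlgebraicGeometry IsLocalRing
open Literature.AlgebraicGeometry.Resolution

universe u

/-! ## Transport of proper models along `k`-isomorphisms of function fields (kernel plumbing) -/

namespace Literature.AlgebraicGeometry.Resolution.ProperModel

variable {k K₁ K₂ : Type u} [Field k] [Field K₁] [Field K₂] [Algebra k K₁] [Algebra k K₂]

/-- The stalk map of the distinguished `K`-point of a proper model is an isomorphism at every
point of `Spec K` (there is only the closed point, where it is `isIso_stalkClosedPointTo`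
composed with the inverse of `stalkClosedPointIso`). [folklore] -/
theorem isIso_stalkMap_gen (M : ProperModel k K₁) (x : ↥(Spec (CommRingCat.of K₁))) :
    IsIso (M.gen.stalkMap x) := by
  obtain rfl : x = closedPoint K₁ := Subsingleton.elim _ _
  haveI : IsIso (M.gen.stalkMap (closedPoint K₁) ≫ (stalkClosedPointIso (CommRingCat.of K₁)).hom) :=
    M.isIso_stalkClosedPointTo
  exact IsIso.of_isIso_comp_right (M.gen.stalkMap (closedPoint K₁))
    (stalkClosedPointIso (CommRingCat.of K₁)).hom

/-- **Transport of a proper model along a `k`-algebra isomorphism of function fields**: if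
`e : K₁ ≃ₐ[k] K₂` and `M` is a proper model of `K₁/k`, the same scheme with the `K₂`-point
`Spec K₂ ≅ Spec K₁ → M` is a proper model of `K₂/k`. [folklore] -/
def ofAlgEquiv (M : ProperModel k K₁) (e : K₁ ≃ₐ[k] K₂) : ProperModel k K₂ where
  X := M.X
  π := M.π
  gen := Spec.map (e.toRingEquiv.toCommRingCatIso).hom ≫ M.gen
  gen_π := by
    rw [Category.assoc, M.gen_π, ← Spec.map_comp]
    congr 1
    apply CommRingCat.hom_ext
    ext x
    change e (algebraMap k K₁ x) = algebraMap k K₂ x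
    exact e.commutes x
  isIntegral := M.isIntegral
  isProper := M.isProper
  genericPt_eq := by
    have hpt : (Spec.map (e.toRingEquiv.toCommRingCatIso).hom) (closedPoint K₂) = closedPoint K₁ :=
      Subsingleton.elim _ _
    rw [Scheme.Hom.comp_apply, hpt]
    exact M.genericPt_eq
  isIso_stalkClosedPointTo := by
    rw [Scheme.stalkClosedPointTo_comp]
    have h₁ : ∀ x, IsIso (M.gen.stalkMap x) := isIso_stalkMap_gen M
    have h₂ : IsIso (Scheme.stalkClosedPointTo (Spec.map (e.toRingEquiv.toCommRingCatIso).hom)) := by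
      unfold Scheme.stalkClosedPointTo
      infer_instance
    exact IsIso.comp_isIso' (h₁ _) h₂

/-- The underlying scheme of the transported model is unchanged. [folklore] -/
@[simp] theorem ofAlgEquiv_X (M : ProperModel k K₁) (e : K₁ ≃ₐ[k] K₂) :
    (M.ofAlgEquiv e).X = M.X := rfl

/-- **Every function field essentially of finite type has a proper model**: for a finite set
`s` of field generators (`IntermediateField.fg_top`), `k[s]` is a finitely generated subalgebra
with `Frac k[s] = K` (`IntermediateField.mem_adjoin_iff_div`), and the projective closure of
`Spec k[s]` is a projective model (`ProjModel.nonempty_of_fg`). [folklore] -/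
theorem nonempty_of_essFiniteType (k K : Type u) [Field k] [Field K] [Algebra k K]
    [Algebra.EssFiniteType k K] : Nonempty (ProperModel k K) := by
  classical
  obtain ⟨s, hs⟩ := IntermediateField.fg_top k K
  let A : Subalgebra k K := Algebra.adjoin k (s : Set K)
  have hA : A.FG := Subalgebra.fg_adjoin_finset s
  haveI : FaithfulSMul A K :=
    (faithfulSMul_iff_algebraMap_injective A K).mpr Subtype.val_injective
  haveI : IsFractionRing A K := IsFractionRing.of_field A K fun z => by
    have hz : z ∈ IntermediateField.adjoin k (s : Set K) := by
      rw [hs]; exact IntermediateField.mem_top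
    obtain ⟨x, hx, y, hy, hxy⟩ := IntermediateField.mem_adjoin_iff_div.mp hz
    exact ⟨⟨x, hx⟩, ⟨y, hy⟩, hxy⟩
  obtain ⟨M⟩ := ProjModel.nonempty_of_fg A hA
  exact ⟨M.toProperModel⟩

end Literature.AlgebraicGeometry.Resolution.ProperModel

namespace Summit.ResolutionOfSingularities.ResolutionOfSingularities.Theorems.QuotientModelsMinimalHeight

/-! ## The pieces -/

/-- Per-prime body of the route aside `QuotientModels.PialtModels` (P, item 27198): every `K/k`
essentially of finite type (char `p`) has a finite purely inseparable extension with a regular proper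
model. `QuotientModels.PialtModels = ∀ p, p.Prime → PialtModelsAt p` by `Iff.rfl`. -/
def PialtModelsAt (p : ℕ) : Prop :=
  ∀ (k : Type) [Field k] [CharP k p] (K : Type) [Field K] [Algebra k K]
    [Algebra.EssFiniteType k K],
    ∃ (L : Type) (_ : Field L) (_ : Algebra k L) (_ : Algebra K L) (_ : IsScalarTower k K L)
      (_ : Module.Finite K L) (_ : IsPurelyInseparable K L),
      ∃ N : Literature.AlgebraicGeometry.Resolution.ProperModel k L,
        Literature.AlgebraicGeometry.Resolution.Scheme.IsRegular N.X

/-- Per-prime body of the route crux `QuotientModels.HeightOneDescent` (H, item 27195): exponent-one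
purely inseparable descent of regular proper models. `QuotientModels.HeightOneDescent = ∀ p, p.Prime →
HeightOneDescentAt p` by `Iff.rfl`. -/
def HeightOneDescentAt (p : ℕ) : Prop :=
  ∀ (k : Type) [Field k] [CharP k p] (K L : Type) [Field K] [Field L] [Algebra k K] [Algebra k L]
    [Algebra K L] [IsScalarTower k K L] [Algebra.EssFiniteType k K] [Module.Finite K L],
    (∀ x : L, x ^ p ∈ (algebraMap K L).range) →
    (∃ N : Literature.AlgebraicGeometry.Resolution.ProperModel k L,
        Literature.AlgebraicGeometry.Resolution.Scheme.IsRegular N.X) →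
      ∃ N : Literature.AlgebraicGeometry.Resolution.ProperModel k K,
        Literature.AlgebraicGeometry.Resolution.Scheme.IsRegular N.X

/-- ONE-RADICAL DESCENT at the prime `p` (H°, lens-4): if `L = K(x)` with `x ^ p ∈ K` (`K⟮x⟯ = ⊤`) and
`L` has a regular proper `k`-model then so has `K`. Equivalent to `HeightOneDescentAt p`
(`heightOneDescentAt_iff_simple`); Jacobson: `K = L^δ` for one p-closed derivation, so `K`-models are
quotients of regular `L`-models by one p-closed rational vector field. -/
def HeightOneDescentSimpleAt (p : ℕ) : Prop :=
  ∀ (k : Type) [Field k] [CharP k p] (K L : Type) [Field K] [Field L] [Algebra k K] [Algebra k L]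
    [Algebra K L] [IsScalarTower k K L] [Algebra.EssFiniteType k K] [Module.Finite K L] (x : L),
    x ^ p ∈ (algebraMap K L).range → IntermediateField.adjoin K {x} = ⊤ →
    (∃ N : Literature.AlgebraicGeometry.Resolution.ProperModel k L,
        Literature.AlgebraicGeometry.Resolution.Scheme.IsRegular N.X) →
      ∃ N : Literature.AlgebraicGeometry.Resolution.ProperModel k K,
        Literature.AlgebraicGeometry.Resolution.Scheme.IsRegular N.X

/-! ## Kernels -/

/-- Necessity of `PialtModelsAt`: take `L := K`. -/
theorem pialtModels_of_regModel {p : ℕ} (h : ProperModel.RegModel.{0} p) : PialtModelsAt p := by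
  intro k _ _ K _ _ _
  obtain ⟨N, hN⟩ := h k K (ProperModel.nonempty_of_essFiniteType k K)
  exact ⟨K, inferInstance, inferInstance, inferInstance, inferInstance, inferInstance,
    inferInstance, N, hN⟩

/-- An intermediate field of a finite extension of a field essentially of finite type is
essentially of finite type. -/
theorem essFiniteType_intermediateField {k K L : Type} [Field k] [Field K] [Field L]
    [Algebra k K] [Algebra k L] [Algebra K L] [IsScalarTower k K L] [Algebra.EssFiniteType k K]
    [Module.Finite K L] (F : IntermediateField K L) : Algebra.EssFiniteType k F := by
  haveI : Module.Finite K F := inferInstance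
  haveI : Algebra.EssFiniteType K F := inferInstance
  exact Algebra.EssFiniteType.comp k K F

/-- Necessity of `HeightOneDescentAt`: ignore the cover. -/
theorem heightOneDescent_of_regModel {p : ℕ} (h : ProperModel.RegModel.{0} p) :
    HeightOneDescentAt p := by
  intro k _ _ K L _ _ _ _ _ _ _ _ _ _
  exact h k K (ProperModel.nonempty_of_essFiniteType k K)

/-- **One descent step between intermediate fields** (the served `HeightOneDescentAt`, stated on
TYPES, applied to a height-one pair `E₂ ≤ E₁` of intermediate fields of a finite `L/K`: the
inclusion `E₂ ↪ E₁` is made an algebra, finite because `E₁ ↪ L` is `E₂`-linear and injective).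
[folklore] -/
theorem descent_step {p : ℕ} (hD : HeightOneDescentAt p) {k K L : Type} [Field k] [CharP k p]
    [Field K] [Field L] [Algebra k K] [Algebra k L] [Algebra K L] [IsScalarTower k K L]
    [Algebra.EssFiniteType k K] [Module.Finite K L] (E₁ E₂ : IntermediateField K L)
    (hle : E₂ ≤ E₁) (hexp : ∀ x : L, x ∈ E₁ → x ^ p ∈ E₂)
    (hN : ∃ N : ProperModel k E₁, Literature.AlgebraicGeometry.Resolution.Scheme.IsRegular N.X) :
    ∃ N : ProperModel k E₂, Literature.AlgebraicGeometry.Resolution.Scheme.IsRegular N.X := by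
  haveI : Algebra.EssFiniteType k E₂ := essFiniteType_intermediateField E₂
  letI : Algebra E₂ E₁ := (IntermediateField.inclusion hle).toRingHom.toAlgebra
  haveI : IsScalarTower k E₂ E₁ := IsScalarTower.of_algebraMap_eq fun x => rfl
  let f : E₁ →ₗ[E₂] L :=
    { toFun := fun x => (x : L)
      map_add' := fun _ _ => rfl
      map_smul' := fun c x => by
        rw [RingHom.id_apply, Algebra.smul_def, RingHom.algebraMap_toAlgebra]
        rfl }
  haveI : Module.Finite E₂ E₁ := Module.Finite.of_injective f Subtype.val_injective
  have hexp' : ∀ x : E₁, x ^ p ∈ (algebraMap E₂ E₁).range := fun x =>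
    ⟨⟨(x : L) ^ p, hexp x x.2⟩, Subtype.ext rfl⟩
  exact hD k E₂ E₁ hexp' hN

/-- **The Frobenius tower** (sufficiency): `PialtModelsAt p → HeightOneDescentAt p → RegModel p`. -/
theorem regModel_of_pialtModels_of_heightOneDescent {p : ℕ} (hp : p.Prime)
    (hP : PialtModelsAt p) (hD : HeightOneDescentAt p) : ProperModel.RegModel.{0} p := by
  intro k _ _ K _ _ _ _
  obtain ⟨L, _, _, _, _, _, _, N, hN⟩ := hP k K
  haveI : Fact p.Prime := ⟨hp⟩
  haveI : CharP K p := (Algebra.charP_iff k K p).mp inferInstance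
  haveI : CharP L p := (Algebra.charP_iff k L p).mp inferInstance
  haveI : ExpChar K p := ExpChar.prime hp
  haveI : ExpChar L p := ExpChar.prime hp
  haveI : IsPurelyInseparable.HasExponent K L := inferInstance
  have he : ∀ a : L, a ^ p ^ IsPurelyInseparable.exponent K L ∈ (algebraMap K L).range :=
    IsPurelyInseparable.exponent_def' K p
  -- the tower `T i = K(L^(p^i))`, `T 0 = L`, `T e = K`
  let T : ℕ → IntermediateField K L := fun i =>
    IntermediateField.adjoin K (Set.range fun x : L => x ^ p ^ i)
  have hanti : ∀ i, T (i + 1) ≤ T i := by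
    intro i
    apply IntermediateField.adjoin_le_iff.mpr
    rintro _ ⟨x, rfl⟩
    show x ^ p ^ (i + 1) ∈ T i
    have hx : x ^ p ^ (i + 1) = (x ^ p ^ i) ^ p := by rw [pow_succ, pow_mul]
    rw [hx]
    exact pow_mem (IntermediateField.subset_adjoin K (Set.range fun y : L => y ^ p ^ i)
      (Set.mem_range_self x)) p
  have hfrob : ∀ i, ∀ y : L, y ∈ T i → y ^ p ∈ T (i + 1) := by
    intro i
    let G : Subfield L := (T (i + 1)).toSubfield.comap (frobenius L p)
    have hGK : ∀ c : K, algebraMap K L c ∈ G := fun c => by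
      change frobenius L p (algebraMap K L c) ∈ (T (i + 1)).toSubfield
      rw [frobenius_def, ← map_pow]
      exact (T (i + 1)).algebraMap_mem (c ^ p)
    have hle : T i ≤ G.toIntermediateField hGK := by
      apply IntermediateField.adjoin_le_iff.mpr
      rintro _ ⟨x, rfl⟩
      change frobenius L p (x ^ p ^ i) ∈ (T (i + 1)).toSubfield
      rw [frobenius_def, ← pow_mul, ← pow_succ]
      exact IntermediateField.subset_adjoin K (Set.range fun y : L => y ^ p ^ (i + 1))
        (Set.mem_range_self x)
    intro y hy
    have hy' : frobenius L p y ∈ (T (i + 1)).toSubfield := hle hy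
    rwa [frobenius_def] at hy'
  -- induction down the tower
  have key : ∀ i, ∃ M : ProperModel k (T i),
      Literature.AlgebraicGeometry.Resolution.Scheme.IsRegular M.X := by
    intro i
    induction i with
    | zero =>
        have htop : T 0 = ⊤ := by
          apply top_le_iff.mp
          intro x _
          have hx : x = x ^ p ^ 0 := by simp
          rw [hx]
          exact IntermediateField.subset_adjoin K (Set.range fun y : L => y ^ p ^ 0)
            (Set.mem_range_self x)
        let eqv : L ≃ₐ[k] (T 0) :=
          ((IntermediateField.topEquiv (F := K) (E := L)).symm.trans
            (IntermediateField.equivOfEq htop.symm)).restrictScalars k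
        exact ⟨N.ofAlgEquiv eqv, hN⟩
    | succ i ih => exact descent_step hD (T i) (T (i + 1)) (hanti i) (hfrob i) ih
  -- the bottom of the tower is `K`
  obtain ⟨Ne, hNe⟩ := key (IsPurelyInseparable.exponent K L)
  have hbot : T (IsPurelyInseparable.exponent K L) = ⊥ := by
    apply le_bot_iff.mp
    apply IntermediateField.adjoin_le_iff.mpr
    rintro _ ⟨x, rfl⟩
    show x ^ p ^ IsPurelyInseparable.exponent K L ∈ (⊥ : IntermediateField K L)
    obtain ⟨c, hc⟩ := he x
    rw [← hc]
    exact (⊥ : IntermediateField K L).algebraMap_mem c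
  let eqv : (T (IsPurelyInseparable.exponent K L)) ≃ₐ[k] K :=
    ((IntermediateField.equivOfEq hbot).trans (IntermediateField.botEquiv K L)).restrictScalars k
  exact ⟨Ne.ofAlgEquiv eqv, hNe⟩

/-- **Exact bisection of Zariski's models half at a prime `p`.** -/
theorem regModel_iff {p : ℕ} (hp : p.Prime) :
    ProperModel.RegModel.{0} p ↔ PialtModelsAt p ∧ HeightOneDescentAt p :=
  ⟨fun h => ⟨pialtModels_of_regModel h, heightOneDescent_of_regModel h⟩,
    fun h => regModel_of_pialtModels_of_heightOneDescent hp h.1 h.2⟩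


end Summit.ResolutionOfSingularities.ResolutionOfSingularities.Theorems.QuotientModelsMinimalHeight

end
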